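import Literature.AlgebraicGeometry.Motives.MixedHodgeExtensionSubQuotient
import Mathlib.LinearAlgebra.Isomorphisms
import HarnessLib

/-!
# Noether's isomorphism theorems for mixed Hodge structures; `Gr^W_k H = W_k H / W_{k-1} H`

Cattani–El Zein–Griffiths–Lê, *Hodge Theory*, Thm. 3.2.18: "The category of mixed Hodge structures is
abelian"; Lemma 3.2.20 and the paragraph after it: kernels, cokernels, images and coimages carry the
induced / quotient filtrations, and "a morphism of MHS which induces an isomorphism on the lattices, is
an isomorphism of MHS" (the tree's `Hom.inverse`). Deligne, *Théorie de Hodge II*, Thm. 2.3.5 (i)–(ii):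
«tout sous-objet, resp. quotient … est muni des filtrations induites, resp. quotient», and Déf. 2.3.1:
`Gr_n^W` carries the Hodge structure induced by `F`.

In an abelian category the isomorphism theorems hold; for the tree's CONCRETE sub-objects
(`SubMixedHodgeStructure`, induced filtrations) and quotients (`SubMixedHodgeStructure.quotient`,
quotient filtrations) this file proves that Mathlib's linear isomorphisms are isomorphisms of mixed
Hodge structures:

* §1 inclusions `S ↪ T` of nested sub-MHS (`SubMixedHodgeStructure.inclusion`, the case `f = id` of the
  tree's `restrictHom`, `Motives/MixedHodgeExtensionSubQuotient`); two mixed Hodge structures with the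
  same filtrations are equal (`MixedHodgeStructure.ext_W_F`).
* §2 **second isomorphism theorem**: `S/(S ∩ T) ⥲ (S + T)/T` is a bijective morphism of MHS
  (`secondIso`, `secondIso_toLinearMap` = Mathlib's `LinearMap.quotientInfToSupQuotient`,
  `secondIso_bijective`), with inverse morphism `secondIsoInv`.
* §3 **third isomorphism theorem**: for `S ⊆ T`, `(H/S)/(T/S) ⥲ H/T` is a bijective morphism of MHS
  (`thirdIso`, `thirdIso_toLinearMap` = Mathlib's `Submodule.quotientQuotientEquivQuotientAux`,
  `thirdIso_bijective`, `thirdIsoInv`); the morphism `H/S → H/T` (`quotientMapLE`, the case `f = id` of the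
  tree's `quotientMap`).
* §4 **correspondence theorem**: sub-MHS of `H/S` ↔ sub-MHS of `H` containing `S`
  (`quotientSubEquiv`: `R ↦ R.comap (H ↠ H/S)`, `T ↦ T.map (H ↠ H/S)`).
* §5 **`Gr^W_k H` is the sub-quotient `W_k H / W_{k-1} H`**: the pure Hodge structure `H.gr k` regarded
  as a mixed one EQUALS the quotient MHS of the sub-MHS `W_k H` by `W_{k-1} H`
  (`gr_toMixedHodgeStructure_eq_quotient`); the projection `W_k H ↠ Gr^W_k H` is a surjective morphism
  of MHS with kernel `W_{k-1} H` (`weightGrMkQ`, `weightGrMkQ_surjective`, `ker_weightGrMkQ`).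

All statements proved; definitions with bodies (morphisms and one `Equiv`); no named facts, no instances.

## References

* [CattaniElZeinGriffithsLe2014] E. Cattani et al. (eds.), Hodge Theory (2014), Thm. 3.2.18, Lemma 3.2.20
  and the paragraph after it (p. 161), Def. 3.2.15.
* [DeligneHodgeII1971] P. Deligne, Théorie de Hodge II, Publ. Math. IHÉS 40 (1971), Déf. 2.3.1,
  Thm. 2.3.5 (i)–(ii).
-/

noncomputable section

open scoped TensorProduct

namespace Literature.AlgebraicGeometry.Motives

namespace MixedHodgeStructure

universe u v

variable {V : Type u} [AddCommGroup V] [Module ℚ V]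
variable {V' : Type v} [AddCommGroup V'] [Module ℚ V']

/-! ### §1 Inclusions of nested sub-MHS; extensionality of mixed Hodge structures -/

/-- **Two mixed Hodge structures on `V` with the same weight and Hodge filtrations are equal** (the
remaining fields are propositions). [cite: DeligneHodgeII1971, Déf. 2.3.1] -/
theorem ext_W_F {H₁ H₂ : MixedHodgeStructure V} (hW : ∀ k, H₁.W k = H₂.W k) (hF : ∀ p, H₁.F p = H₂.F p) :
    H₁ = H₂ := by
  obtain ⟨W₁, _, _, _, F₁, _, _, _, _⟩ := H₁
  obtain ⟨W₂, _, _, _, F₂, _, _, _, _⟩ := H₂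
  obtain rfl : W₁ = W₂ := funext hW
  obtain rfl : F₁ = F₂ := funext hF
  rfl

namespace SubMixedHodgeStructure

variable {H : MixedHodgeStructure V}

/-- **The inclusion `S ↪ T` of nested sub-MHS is a morphism of MHS** (for the induced filtrations).
[cite: CattaniElZeinGriffithsLe2014, Lemma 3.2.20] -/
def inclusion {S T : SubMixedHodgeStructure H} (h : S.toSubmodule ≤ T.toSubmodule) :
    Hom S.toMixedHodgeStructure T.toMixedHodgeStructure :=
  S.restrictHom T (Hom.id H) fun _ hx => h hx

/-- Underlying map of `inclusion h`: Mathlib's `Submodule.inclusion h` (by `rfl`).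
[cite: CattaniElZeinGriffithsLe2014, Lemma 3.2.20] -/
@[simp]
theorem inclusion_toLinearMap {S T : SubMixedHodgeStructure H} (h : S.toSubmodule ≤ T.toSubmodule) :
    (inclusion h).toLinearMap = Submodule.inclusion h := rfl

/-- `(T ↪ H) ∘ (S ↪ T) = (S ↪ H)`. [cite: CattaniElZeinGriffithsLe2014, Lemma 3.2.20] -/
theorem subtype_comp_inclusion {S T : SubMixedHodgeStructure H} (h : S.toSubmodule ≤ T.toSubmodule) :
    T.subtype.comp (inclusion h) = S.subtype :=
  Hom.ext (LinearMap.ext fun _ => rfl)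

/-- `inclusion h` is injective. [cite: CattaniElZeinGriffithsLe2014, Lemma 3.2.20] -/
theorem inclusion_injective {S T : SubMixedHodgeStructure H} (h : S.toSubmodule ≤ T.toSubmodule) :
    Function.Injective (inclusion h).toLinearMap :=
  Submodule.inclusion_injective h

/-! ### §2 The second isomorphism theorem `S/(S ∩ T) ≅ (S + T)/T` -/

/-- The morphism `S → (S + T)/T` (inclusion followed by the projection). [cite: CattaniElZeinGriffithsLe2014, Thm. 3.2.18] -/
def subToSupQuotient (S T : SubMixedHodgeStructure H) :
    Hom S.toMixedHodgeStructure (T.comap (S.sup T).subtype).quotient :=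
  (T.comap (S.sup T).subtype).mkQ.comp (inclusion (show S.toSubmodule ≤ (S.sup T).toSubmodule from le_sup_left))

/-- Underlying map of `subToSupQuotient`: Mathlib's `LinearMap.subToSupQuotient` (by `rfl`).
[cite: CattaniElZeinGriffithsLe2014, Thm. 3.2.18] -/
theorem subToSupQuotient_toLinearMap (S T : SubMixedHodgeStructure H) :
    (subToSupQuotient S T).toLinearMap = LinearMap.subToSupQuotient S.toSubmodule T.toSubmodule := rfl

/-- **Second isomorphism theorem, the morphism `S/(S ∩ T) → (S + T)/T` of mixed Hodge structures**
(`S ∩ T ⊆ S` as the sub-MHS `S ∩ S⁻¹... = comap (S ↪ H) S ⊓ comap (S ↪ H) T`, Mathlib's normal form).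
[cite: CattaniElZeinGriffithsLe2014, Thm. 3.2.18] -/
def secondIso (S T : SubMixedHodgeStructure H) :
    Hom ((S.comap S.subtype).inf (T.comap S.subtype)).quotient (T.comap (S.sup T).subtype).quotient :=
  ((S.comap S.subtype).inf (T.comap S.subtype)).quotientLift (subToSupQuotient S T)
    (LinearMap.comap_leq_ker_subToSupQuotient S.toSubmodule T.toSubmodule)

/-- Underlying map of `secondIso`: Mathlib's `LinearMap.quotientInfToSupQuotient` (by `rfl`).
[cite: CattaniElZeinGriffithsLe2014, Thm. 3.2.18] -/
@[simp]
theorem secondIso_toLinearMap (S T : SubMixedHodgeStructure H) :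
    (secondIso S T).toLinearMap = LinearMap.quotientInfToSupQuotient S.toSubmodule T.toSubmodule := rfl

/-- **Second isomorphism theorem: `S/(S ∩ T) → (S + T)/T` is bijective.** [cite: CattaniElZeinGriffithsLe2014, Thm. 3.2.18] -/
theorem secondIso_bijective (S T : SubMixedHodgeStructure H) : Function.Bijective (secondIso S T).toLinearMap :=
  ⟨LinearMap.quotientInfEquivSupQuotient_injective S.toSubmodule T.toSubmodule,
    LinearMap.quotientInfEquivSupQuotient_surjective S.toSubmodule T.toSubmodule⟩

/-- **The inverse `(S + T)/T → S/(S ∩ T)` is a morphism of MHS** (a bijective morphism of MHS is an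
isomorphism, the tree's `Hom.inverse`). [cite: CattaniElZeinGriffithsLe2014, Thm. 3.2.18] -/
def secondIsoInv (S T : SubMixedHodgeStructure H) :
    Hom (T.comap (S.sup T).subtype).quotient ((S.comap S.subtype).inf (T.comap S.subtype)).quotient :=
  (secondIso S T).inverse (secondIso_bijective S T)

/-- Underlying map of `secondIsoInv`: the inverse of Mathlib's `LinearMap.quotientInfEquivSupQuotient`.
[cite: CattaniElZeinGriffithsLe2014, Thm. 3.2.18] -/
theorem secondIsoInv_toLinearMap_apply (S T : SubMixedHodgeStructure H)
    (y : ↥(S.sup T).toSubmodule ⧸ (T.comap (S.sup T).subtype).toSubmodule) :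
    (secondIsoInv S T).toLinearMap y = (LinearMap.quotientInfEquivSupQuotient S.toSubmodule T.toSubmodule).symm y :=
  rfl

/-- `secondIsoInv ∘ secondIso = id` on vectors. [cite: CattaniElZeinGriffithsLe2014, Thm. 3.2.18] -/
@[simp]
theorem secondIsoInv_secondIso_apply (S T : SubMixedHodgeStructure H)
    (x : ↥S.toSubmodule ⧸ ((S.comap S.subtype).inf (T.comap S.subtype)).toSubmodule) :
    (secondIsoInv S T).toLinearMap ((secondIso S T).toLinearMap x) = x :=
  (LinearEquiv.ofBijective _ (secondIso_bijective S T)).symm_apply_apply x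

/-- `secondIso ∘ secondIsoInv = id` on vectors. [cite: CattaniElZeinGriffithsLe2014, Thm. 3.2.18] -/
@[simp]
theorem secondIso_secondIsoInv_apply (S T : SubMixedHodgeStructure H)
    (y : ↥(S.sup T).toSubmodule ⧸ (T.comap (S.sup T).subtype).toSubmodule) :
    (secondIso S T).toLinearMap ((secondIsoInv S T).toLinearMap y) = y :=
  (LinearEquiv.ofBijective _ (secondIso_bijective S T)).apply_symm_apply y

/-! ### §3 The third isomorphism theorem `(H/S)/(T/S) ≅ H/T` -/

/-- **The morphism `H/S → H/T` for nested sub-MHS `S ⊆ T`** (the tree's `quotientMap` for `f = id`).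
[cite: CattaniElZeinGriffithsLe2014, Thm. 3.2.18] -/
def quotientMapLE {S T : SubMixedHodgeStructure H} (h : S.toSubmodule ≤ T.toSubmodule) : Hom S.quotient T.quotient :=
  S.quotientMap T (Hom.id H) fun _ hx => h hx

/-- `quotientMapLE h [x] = [x]`. [cite: CattaniElZeinGriffithsLe2014, Thm. 3.2.18] -/
@[simp]
theorem quotientMapLE_toLinearMap_mk {S T : SubMixedHodgeStructure H} (h : S.toSubmodule ≤ T.toSubmodule) (x : V) :
    (quotientMapLE h).toLinearMap (Submodule.Quotient.mk x) = Submodule.Quotient.mk x := rfl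

/-- Underlying map of `quotientMapLE h`: Mathlib's `Submodule.mapQ S T id h`. [cite: CattaniElZeinGriffithsLe2014, Thm. 3.2.18] -/
theorem quotientMapLE_toLinearMap {S T : SubMixedHodgeStructure H} (h : S.toSubmodule ≤ T.toSubmodule) :
    (quotientMapLE h).toLinearMap = Submodule.mapQ S.toSubmodule T.toSubmodule LinearMap.id h :=
  Submodule.linearMap_qext _ rfl

/-- `quotientMapLE h` is surjective. [cite: CattaniElZeinGriffithsLe2014, Thm. 3.2.18] -/
theorem quotientMapLE_surjective {S T : SubMixedHodgeStructure H} (h : S.toSubmodule ≤ T.toSubmodule) :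
    Function.Surjective (quotientMapLE h).toLinearMap := by
  intro y
  induction y using Submodule.Quotient.induction_on with
  | _ x => exact ⟨Submodule.Quotient.mk x, rfl⟩

/-- The kernel of `H/S → H/T` is `T/S`. [cite: CattaniElZeinGriffithsLe2014, Thm. 3.2.18] -/
theorem ker_quotientMapLE {S T : SubMixedHodgeStructure H} (h : S.toSubmodule ≤ T.toSubmodule) :
    LinearMap.ker (quotientMapLE h).toLinearMap = T.toSubmodule.map S.toSubmodule.mkQ := by
  rw [quotientMapLE_toLinearMap, Submodule.ker_mapQ, Submodule.comap_id]

/-- **Third isomorphism theorem, the morphism `(H/S)/(T/S) → H/T` of mixed Hodge structures** (`T/S`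
is the sub-MHS `T.map (H ↠ H/S)` of `H/S`). [cite: CattaniElZeinGriffithsLe2014, Thm. 3.2.18] -/
def thirdIso {S T : SubMixedHodgeStructure H} (h : S.toSubmodule ≤ T.toSubmodule) :
    Hom (T.map S.mkQ).quotient T.quotient :=
  (T.map S.mkQ).quotientLift (quotientMapLE h) (by rw [ker_quotientMapLE]; exact le_rfl)

/-- `thirdIso h [[x]] = [x]`. [cite: CattaniElZeinGriffithsLe2014, Thm. 3.2.18] -/
@[simp]
theorem thirdIso_toLinearMap_mk_mk {S T : SubMixedHodgeStructure H} (h : S.toSubmodule ≤ T.toSubmodule) (x : V) :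
    (thirdIso h).toLinearMap (Submodule.Quotient.mk (Submodule.Quotient.mk x)) = Submodule.Quotient.mk x := rfl

/-- Underlying map of `thirdIso h`: Mathlib's `Submodule.quotientQuotientEquivQuotientAux S T h`.
[cite: CattaniElZeinGriffithsLe2014, Thm. 3.2.18] -/
theorem thirdIso_toLinearMap {S T : SubMixedHodgeStructure H} (h : S.toSubmodule ≤ T.toSubmodule) :
    (thirdIso h).toLinearMap = Submodule.quotientQuotientEquivQuotientAux S.toSubmodule T.toSubmodule h := by
  refine Submodule.linearMap_qext _ (Submodule.linearMap_qext _ (LinearMap.ext fun x => ?_))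
  rfl

/-- **Third isomorphism theorem: `(H/S)/(T/S) → H/T` is bijective.** [cite: CattaniElZeinGriffithsLe2014, Thm. 3.2.18] -/
theorem thirdIso_bijective {S T : SubMixedHodgeStructure H} (h : S.toSubmodule ≤ T.toSubmodule) :
    Function.Bijective (thirdIso h).toLinearMap := by
  rw [thirdIso_toLinearMap]
  exact (Submodule.quotientQuotientEquivQuotient S.toSubmodule T.toSubmodule h).bijective

/-- **The inverse `H/T → (H/S)/(T/S)` is a morphism of MHS.** [cite: CattaniElZeinGriffithsLe2014, Thm. 3.2.18] -/
def thirdIsoInv {S T : SubMixedHodgeStructure H} (h : S.toSubmodule ≤ T.toSubmodule) :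
    Hom T.quotient (T.map S.mkQ).quotient :=
  (thirdIso h).inverse (thirdIso_bijective h)

/-- `thirdIsoInv h [x] = [[x]]`. [cite: CattaniElZeinGriffithsLe2014, Thm. 3.2.18] -/
@[simp]
theorem thirdIsoInv_toLinearMap_mk {S T : SubMixedHodgeStructure H} (h : S.toSubmodule ≤ T.toSubmodule) (x : V) :
    (thirdIsoInv h).toLinearMap (Submodule.Quotient.mk x) = Submodule.Quotient.mk (Submodule.Quotient.mk x) := by
  have hb := thirdIso_bijective h
  apply hb.1
  change (thirdIso h).toLinearMap ((LinearEquiv.ofBijective _ hb).symm (Submodule.Quotient.mk x)) = _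
  rw [show (thirdIso h).toLinearMap ((LinearEquiv.ofBijective _ hb).symm (Submodule.Quotient.mk x)) =
    (LinearEquiv.ofBijective _ hb) ((LinearEquiv.ofBijective _ hb).symm (Submodule.Quotient.mk x)) from rfl,
    LinearEquiv.apply_symm_apply]
  rfl

/-! ### §4 The correspondence theorem: sub-MHS of `H/S` ↔ sub-MHS of `H` containing `S` -/

/-- `S ⊆ (H ↠ H/S)⁻¹(R)` for every sub-MHS `R` of `H/S`. [cite: CattaniElZeinGriffithsLe2014, Lemma 3.2.20] -/
theorem le_comap_mkQ (S : SubMixedHodgeStructure H) (R : SubMixedHodgeStructure S.quotient) :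
    S.toSubmodule ≤ (R.comap S.mkQ).toSubmodule := by
  intro x hx
  rw [comap_toSubmodule, Submodule.mem_comap]
  have h0 : S.mkQ.toLinearMap x = 0 := (Submodule.Quotient.mk_eq_zero _).2 hx
  rw [h0]
  exact Submodule.zero_mem _

/-- `((H ↠ H/S)⁻¹ R).map (H ↠ H/S) = R`. [cite: CattaniElZeinGriffithsLe2014, Lemma 3.2.20] -/
theorem map_mkQ_comap_mkQ (S : SubMixedHodgeStructure H) (R : SubMixedHodgeStructure S.quotient) :
    (R.comap S.mkQ).map S.mkQ = R :=
  ext (by rw [map_toSubmodule, comap_toSubmodule, Submodule.map_comap_eq_of_surjective S.mkQ_surjective])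

/-- `(T.map (H ↠ H/S)).comap (H ↠ H/S) = T` for `S ⊆ T`. [cite: CattaniElZeinGriffithsLe2014, Lemma 3.2.20] -/
theorem comap_mkQ_map_mkQ (S : SubMixedHodgeStructure H) {T : SubMixedHodgeStructure H}
    (h : S.toSubmodule ≤ T.toSubmodule) : (T.map S.mkQ).comap S.mkQ = T :=
  ext (by
    rw [comap_toSubmodule, map_toSubmodule, show S.mkQ.toLinearMap = S.toSubmodule.mkQ from rfl,
      Submodule.comap_map_mkQ, sup_eq_right.2 h])

/-- **Correspondence theorem**: the sub-mixed Hodge structures of `H/S` correspond bijectively to the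
sub-mixed Hodge structures of `H` containing `S`, by preimage and image along `H ↠ H/S`.
[cite: CattaniElZeinGriffithsLe2014, Lemma 3.2.20] -/
def quotientSubEquiv (S : SubMixedHodgeStructure H) :
    SubMixedHodgeStructure S.quotient ≃ {T : SubMixedHodgeStructure H // S.toSubmodule ≤ T.toSubmodule} where
  toFun R := ⟨R.comap S.mkQ, le_comap_mkQ S R⟩
  invFun T := T.1.map S.mkQ
  left_inv R := map_mkQ_comap_mkQ S R
  right_inv T := Subtype.ext (comap_mkQ_map_mkQ S T.2)

/-- The correspondence is monotone (preimage direction). [cite: CattaniElZeinGriffithsLe2014, Lemma 3.2.20] -/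
theorem quotientSubEquiv_mono (S : SubMixedHodgeStructure H) {R R' : SubMixedHodgeStructure S.quotient}
    (h : R.toSubmodule ≤ R'.toSubmodule) :
    (quotientSubEquiv S R).1.toSubmodule ≤ (quotientSubEquiv S R').1.toSubmodule :=
  Submodule.comap_mono h

/-- The correspondence is monotone (image direction). [cite: CattaniElZeinGriffithsLe2014, Lemma 3.2.20] -/
theorem quotientSubEquiv_symm_mono (S : SubMixedHodgeStructure H)
    {T T' : {T : SubMixedHodgeStructure H // S.toSubmodule ≤ T.toSubmodule}} (h : T.1.toSubmodule ≤ T'.1.toSubmodule) :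
    ((quotientSubEquiv S).symm T).toSubmodule ≤ ((quotientSubEquiv S).symm T').toSubmodule :=
  Submodule.map_mono h

/-! ### §5 `Gr^W_k H = W_k H / W_{k-1} H` as mixed Hodge structures -/

/-- The sub-MHS `W_{k-1} H ⊆ W_k H` of the sub-MHS `W_k H` (the tree's `SubMixedHodgeStructure.weight`).
[cite: CattaniElZeinGriffithsLe2014, Def. 3.2.15] -/
def weightPred (H : MixedHodgeStructure V) (k : ℤ) : SubMixedHodgeStructure (weight H k).toMixedHodgeStructure :=
  (weight H (k - 1)).comap (weight H k).subtype

/-- The underlying subspace of `weightPred H k` is `W_{k-1} ∩ W_k ⊆ W_k`, i.e. the tree's `subPiece H.W k`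
(by `rfl`). [cite: CattaniElZeinGriffithsLe2014, Def. 3.2.15] -/
theorem weightPred_toSubmodule (H : MixedHodgeStructure V) (k : ℤ) :
    (weightPred H k).toSubmodule = subPiece H.W k := rfl

/-- **`Gr^W_k H` (the pure Hodge structure `H.gr k` regarded as a mixed Hodge structure) IS the quotient
mixed Hodge structure `W_k H / W_{k-1} H`** — same underlying space `Gr^W_k V`, same filtrations: the
quotient weight filtration is trivial of weight `k`, the quotient Hodge filtration is the induced `F`
(Deligne, Déf. 2.3.1; Cattani et al., Def. 3.2.15). [cite: DeligneHodgeII1971, Déf. 2.3.1]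
[cite: CattaniElZeinGriffithsLe2014, Def. 3.2.15] -/
theorem gr_toMixedHodgeStructure_eq_quotient (H : MixedHodgeStructure V) (k : ℤ) :
    (H.gr k).toMixedHodgeStructure = (weightPred H k).quotient := by
  refine ext_W_F (fun j => ?_) (fun p => rfl)
  rw [HodgeStructure.toMixedHodgeStructure_W, quotient_W]
  change HodgeStructure.trivialWeightFiltration _ k j = ((H.W j).comap (H.W k).subtype).map (subPiece H.W k).mkQ
  by_cases hj : j < k
  · rw [HodgeStructure.trivialWeightFiltration_of_lt hj, eq_comm, eq_bot_iff]
    rintro _ ⟨x, hx, rfl⟩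
    rw [Submodule.mem_bot, Submodule.mkQ_apply, Submodule.Quotient.mk_eq_zero]
    exact H.monotone_W (show j ≤ k - 1 by omega) hx
  · rw [HodgeStructure.trivialWeightFiltration_of_le (not_lt.1 hj), eq_comm, eq_top_iff]
    intro y _
    induction y using Submodule.Quotient.induction_on with
    | _ x => exact ⟨x, H.monotone_W (not_lt.1 hj) x.2, rfl⟩

/-- **The projection `W_k H ↠ Gr^W_k H` is a morphism of mixed Hodge structures** (onto the pure Hodge
structure `H.gr k` regarded as a mixed one). [cite: DeligneHodgeII1971, Déf. 2.3.1] -/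
def weightGrMkQ (H : MixedHodgeStructure V) (k : ℤ) :
    Hom (weight H k).toMixedHodgeStructure (H.gr k).toMixedHodgeStructure where
  toLinearMap := (subPiece H.W k).mkQ
  map_W_le j := by
    rw [gr_toMixedHodgeStructure_eq_quotient]
    exact (weightPred H k).mkQ.map_W_le j
  map_F_le p := by
    rw [gr_toMixedHodgeStructure_eq_quotient]
    exact (weightPred H k).mkQ.map_F_le p

/-- `weightGrMkQ` on vectors is the class map `x ↦ [x]` (by `rfl`). [cite: DeligneHodgeII1971, Déf. 2.3.1] -/
@[simp]
theorem weightGrMkQ_toLinearMap_apply (H : MixedHodgeStructure V) (k : ℤ) (x : ↥(H.W k)) :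
    (weightGrMkQ H k).toLinearMap x = Submodule.Quotient.mk x := rfl

/-- `W_k H ↠ Gr^W_k H` is surjective. [cite: DeligneHodgeII1971, Déf. 2.3.1] -/
theorem weightGrMkQ_surjective (H : MixedHodgeStructure V) (k : ℤ) :
    Function.Surjective (weightGrMkQ H k).toLinearMap :=
  Submodule.mkQ_surjective _

/-- The kernel of `W_k H ↠ Gr^W_k H` is `W_{k-1} H ∩ W_k H`. [cite: DeligneHodgeII1971, Déf. 2.3.1] -/
theorem ker_weightGrMkQ (H : MixedHodgeStructure V) (k : ℤ) :
    LinearMap.ker (weightGrMkQ H k).toLinearMap = subPiece H.W k :=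
  Submodule.ker_mkQ _

/-- **`0 → W_{k-1} H → W_k H → Gr^W_k H → 0` is a short exact sequence of mixed Hodge structures**
(exactness in the middle; the ends are `inclusion_injective` and `weightGrMkQ_surjective`).
[cite: DeligneHodgeII1971, Déf. 2.3.1] -/
theorem exact_inclusion_weightGrMkQ (H : MixedHodgeStructure V) (k : ℤ) :
    Function.Exact (inclusion (weight_mono H (show k - 1 ≤ k by omega))).toLinearMap
      (weightGrMkQ H k).toLinearMap := by
  refine LinearMap.exact_iff.2 ?_
  rw [ker_weightGrMkQ, inclusion_toLinearMap, Submodule.range_inclusion]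
  rfl

/-- **Universal property of `Gr^W_k H`**: a morphism `W_k H → H'` of mixed Hodge structures vanishing on
`W_{k-1} H` factors through a morphism `Gr^W_k H → H'`. [cite: CattaniElZeinGriffithsLe2014, Lemma 3.2.20] -/
def grLift (H : MixedHodgeStructure V) (k : ℤ) {H' : MixedHodgeStructure V'}
    (g : Hom (weight H k).toMixedHodgeStructure H') (hg : subPiece H.W k ≤ LinearMap.ker g.toLinearMap) :
    Hom (H.gr k).toMixedHodgeStructure H' where
  toLinearMap := (subPiece H.W k).liftQ g.toLinearMap hg
  map_W_le j := by
    rw [gr_toMixedHodgeStructure_eq_quotient]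
    exact ((weightPred H k).quotientLift g hg).map_W_le j
  map_F_le p := by
    rw [gr_toMixedHodgeStructure_eq_quotient]
    exact ((weightPred H k).quotientLift g hg).map_F_le p

/-- `grLift g [x] = g x`. [cite: CattaniElZeinGriffithsLe2014, Lemma 3.2.20] -/
@[simp]
theorem grLift_toLinearMap_mk (H : MixedHodgeStructure V) (k : ℤ) {H' : MixedHodgeStructure V'}
    (g : Hom (weight H k).toMixedHodgeStructure H') (hg : subPiece H.W k ≤ LinearMap.ker g.toLinearMap)
    (x : ↥(H.W k)) : (grLift H k g hg).toLinearMap (Submodule.Quotient.mk x) = g.toLinearMap x := rfl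

/-- `grLift g ∘ (W_k H ↠ Gr^W_k H) = g`. [cite: CattaniElZeinGriffithsLe2014, Lemma 3.2.20] -/
theorem grLift_comp_weightGrMkQ (H : MixedHodgeStructure V) (k : ℤ) {H' : MixedHodgeStructure V'}
    (g : Hom (weight H k).toMixedHodgeStructure H') (hg : subPiece H.W k ≤ LinearMap.ker g.toLinearMap) :
    (grLift H k g hg).comp (weightGrMkQ H k) = g :=
  Hom.ext (LinearMap.ext fun _ => rfl)

end SubMixedHodgeStructure

end MixedHodgeStructure

end Literature.AlgebraicGeometry.Motives
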